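import Mathlib.AlgebraicGeometry.AlgClosed.Basic
import Literature.AlgebraicGeometry.Motives.BaseChange
import Literature.AlgebraicGeometry.Motives.FamiliesVHS
import HarnessLib

/-!
# Fibres and base change along a field homomorphism: transitivity of fibre products
# (Görtz–Wedhorn I, Prop. 4.16, §(4.7)–(4.8); Prop. 3.35 / Cor. 3.36)

Topic `Literature/AlgebraicGeometry/Motives` (family `hodge`). Textbook plumbing on the REAL carriers of
`Motives/BaseChange.lean` (`baseChangeHom σ : SchemeOver k ⥤ SchemeOver L`, `baseChangeHomFst σ X : X ⊗_σ L ⟶ X`),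
`Motives/FamiliesVHS.lean` (`fiberOver f s`, `fiberι`, `fiberOverToSpec`) and `Motives/AlgPoints.lean` (`AlgPoints`),
all PROVED (no named fact), formalising three standard statements:

* **Transitivity of base change** (Görtz–Wedhorn I, Prop. 4.16: *"for all morphisms `S'' → S'` we have a canonical
  isomorphism `X_{(S')} ×_{S'} S'' ≅ X_{(S'')}`"*; (4.7)): for field homomorphisms `σ : k →+* L`, `τ : L →+* M` and a
  `k`-scheme `X`, `X ⊗_{τ ∘ σ} M ≅ (X ⊗_σ L) ⊗_τ M` over `M` (`baseChangeHomCompObjIso`), and the variant along an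
  equation `τ ∘ σ = ρ` (`baseChangeHomObjIsoOfComp`), with their compatibility with the projections to `X`.
* **The fibre of a base-changed family is the base change of the fibre** (loc. cit. Prop. 4.16 with §(4.8)
  Def. 4.25 — *"the fiber … `X_s := X ⊗_S κ(s)`"*; Hartshorne II.3 p. 89): for `f₀ : 𝒳₀ ⟶ S₀` over `k`, a `k`-point
  `x ∈ S₀(k)` and an `L`-point `t` of `S₀ ⊗_σ L` lying over `x` (`t.left ≫ pr = Spec σ ≫ x`),
  `(f₀ ⊗_σ L)⁻¹(t) ≅ (f₀⁻¹(x)) ⊗_σ L` over `L` (`fiberOverBaseChangeHomIso`), compatibly with the fibre inclusions.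
* **Points of `S₀ ⊗_σ L` over closed points come from `k`-points** when `k` is algebraically closed and `S₀` is
  locally of finite type (Görtz–Wedhorn I, Prop. 3.35 / Cor. 3.36: closed points are very dense and are exactly the
  `k`-valued points — Hilbert's Nullstellensatz, Mathlib `AlgebraicGeometry.pointOfClosedPoint`; with Prop. 3.8: a
  morphism `Spec L → S₀` is a point plus an embedding of its residue field, Mathlib
  `Scheme.descResidueField_stalkClosedPointTo_fromSpecResidueField`): an `L`-point `t` of `S₀ ⊗_σ L` whose image in
  `S₀` is a closed point lies over a `k`-point `x` (`exists_algPoints_over_of_isClosed`).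

Mathlib route: every isomorphism is `IsPullback.isoIsPullback` between two presentations of the same fibre product
(`IsPullback.paste_horiz`, `IsPullback.of_bot`, `IsPullback.of_hasPullback`), so the compatibilities with the
projections are `IsPullback.isoIsPullback_hom_fst/snd`. Related tree lemmas (same-field situations, not used here to
keep the imports of this file at the level of `Motives/BaseChange`): `HodgeTheory.fiberOverFamilyPullbackIso`
(fibres of a pulled-back family over the same field), `Motives.isPullback_baseChangeHom_map_left`
(`Motives/CyclesBaseChange`) and `HodgeTheory.SpreadingOutQbar.isPullback_baseChangeHom_map_left` (the square
`𝒳₀ ⊗ L = 𝒳₀ ×_{S₀} (S₀ ⊗ L)`, re-proved below as a private helper), `HodgeTheory.exists_algPoint_baseChangeHom_over`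
(`AlgebraicCyclesDefinedOverQbar`: the converse direction, a complex point over a given rational point).

Consumer: `Summits/HodgeConjecture` (Ring 2, route `deform`, node `QbarFibreDescent`: the fibre of a `ℚ̄`-family
base-changed to `ℂ` over a `ℚ̄`-point is the complexification of the `ℚ̄`-fibre; research route conditional on
HC_CM; not a corollary; Q11.4-sentence-2 already refuted in dim ≥ 3). No junk values; no `sorry`; no named fact.
-/

noncomputable section

open CategoryTheory CategoryTheory.Limits AlgebraicGeometry

universe u

namespace Literature.AlgebraicGeometry.Motives

variable {k L : Type u} [Field k] [Field L] (σ : k →+* L)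

/-- The structure map of `Spec L` over itself is the identity (helper; cf. the copies
`Motives.AlgPoints.specOver_self_hom`, `HodgeTheory.SpreadingOutQbar.specOver_self_hom` in heavier files).
[folklore] -/
private theorem specOver_self_hom' (L : Type u) [Field L] : (specOver L L).hom = 𝟙 (specOver L L).left := by
  change Spec.map (CommRingCat.ofHom (algebraMap L L)) = _
  rw [Algebra.algebraMap_self, CommRingCat.ofHom_id, Spec.map_id]
  rfl

/-! ## Transitivity of base change: `X ⊗_{τ ∘ σ} M ≅ (X ⊗_σ L) ⊗_τ M` -/

section Comp

variable {M : Type u} [Field M] (τ : L →+* M) (X : SchemeOver k)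

/-- `(X ⊗_σ L) ⊗_τ M` is the fibre product of `X → Spec k` along `Spec M → Spec L → Spec k` (pasting of the two
base-change squares; Görtz–Wedhorn I, Prop. 4.16). [cite: GortzWedhorn2020, Prop. 4.16 and §(4.7)] -/
theorem isPullback_baseChangeHom_baseChangeHom :
    IsPullback (baseChangeHomFst τ ((baseChangeHom σ).obj X) ≫ baseChangeHomFst σ X)
      ((baseChangeHom τ).obj ((baseChangeHom σ).obj X)).hom X.hom
      (Spec.map (CommRingCat.ofHom τ) ≫ Spec.map (CommRingCat.ofHom σ)) :=
  (IsPullback.of_hasPullback ((baseChangeHom σ).obj X).hom (Spec.map (CommRingCat.ofHom τ))).paste_horiz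
    (IsPullback.of_hasPullback X.hom (Spec.map (CommRingCat.ofHom σ)))

/-- `X ⊗_{τ ∘ σ} M` is the fibre product of `X → Spec k` along `Spec M → Spec L → Spec k`
(`Spec (τ ∘ σ) = Spec τ ≫ Spec σ`; Görtz–Wedhorn I, §(4.7)). [cite: GortzWedhorn2020, Prop. 4.16 and §(4.7)] -/
theorem isPullback_baseChangeHom_comp :
    IsPullback (baseChangeHomFst (τ.comp σ) X) ((baseChangeHom (τ.comp σ)).obj X).hom X.hom
      (Spec.map (CommRingCat.ofHom τ) ≫ Spec.map (CommRingCat.ofHom σ)) := by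
  have h : Spec.map (CommRingCat.ofHom (τ.comp σ)) =
      Spec.map (CommRingCat.ofHom τ) ≫ Spec.map (CommRingCat.ofHom σ) := by
    rw [← Spec.map_comp]; rfl
  exact h ▸ IsPullback.of_hasPullback X.hom (Spec.map (CommRingCat.ofHom (τ.comp σ)))

/-- **Transitivity of base change** (Görtz–Wedhorn I, Prop. 4.16: *"for all morphisms `S'' → S'` we have a
canonical isomorphism `X_{(S')} ×_{S'} S'' ≅ X_{(S'')}`"*, case `S = Spec k`, `S' = Spec L`, `S'' = Spec M`): the
isomorphism of `M`-schemes `X ⊗_{τ ∘ σ} M ≅ (X ⊗_σ L) ⊗_τ M`. [cite: GortzWedhorn2020, Prop. 4.16 and §(4.7)] -/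
def baseChangeHomCompObjIso :
    (baseChangeHom (τ.comp σ)).obj X ≅ (baseChangeHom τ).obj ((baseChangeHom σ).obj X) :=
  Over.isoMk ((isPullback_baseChangeHom_comp σ τ X).isoIsPullback _ _
      (isPullback_baseChangeHom_baseChangeHom σ τ X))
    ((isPullback_baseChangeHom_comp σ τ X).isoIsPullback_hom_snd _ _
      (isPullback_baseChangeHom_baseChangeHom σ τ X))

/-- `baseChangeHomCompObjIso` commutes with the projections to `X`. [cite: GortzWedhorn2020, Prop. 4.16 and §(4.7)] -/
@[reassoc]
theorem baseChangeHomCompObjIso_hom_left_fst :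
    (baseChangeHomCompObjIso σ τ X).hom.left ≫ baseChangeHomFst τ ((baseChangeHom σ).obj X) ≫
      baseChangeHomFst σ X = baseChangeHomFst (τ.comp σ) X :=
  (isPullback_baseChangeHom_comp σ τ X).isoIsPullback_hom_fst _ _
    (isPullback_baseChangeHom_baseChangeHom σ τ X)

/-- Transitivity of base change along an equation `τ ∘ σ = ρ` of field homomorphisms:
`(X ⊗_σ L) ⊗_τ M ≅ X ⊗_ρ M` over `M` (Görtz–Wedhorn I, Prop. 4.16; the form used when `σ : ℚ̄ →+* ℂ` is factored
through the algebraic numbers `ℚ̄ ≅ ℚ^al ⊂ ℂ`). [cite: GortzWedhorn2020, Prop. 4.16 and §(4.7)] -/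
def baseChangeHomObjIsoOfComp (ρ : k →+* M) (h : τ.comp σ = ρ) (X : SchemeOver k) :
    (baseChangeHom τ).obj ((baseChangeHom σ).obj X) ≅ (baseChangeHom ρ).obj X :=
  (baseChangeHomCompObjIso σ τ X).symm ≪≫ eqToIso (by subst h; rfl)

/-- `baseChangeHomObjIsoOfComp` commutes with the projections to `X`. [cite: GortzWedhorn2020, Prop. 4.16 and §(4.7)] -/
@[reassoc]
theorem baseChangeHomObjIsoOfComp_hom_left_fst (ρ : k →+* M) (h : τ.comp σ = ρ) (X : SchemeOver k) :
    (baseChangeHomObjIsoOfComp σ τ ρ h X).hom.left ≫ baseChangeHomFst ρ X =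
      baseChangeHomFst τ ((baseChangeHom σ).obj X) ≫ baseChangeHomFst σ X := by
  subst h
  change ((baseChangeHomCompObjIso σ τ X).inv ≫ 𝟙 _).left ≫ _ = _
  rw [Category.comp_id, ← baseChangeHomCompObjIso_hom_left_fst σ τ X, ← Over.comp_left_assoc,
    Iso.inv_hom_id, Over.id_left, Category.id_comp]

end Comp

/-! ## The fibre of a base-changed family over a point lying over a rational point -/

section Fiber

variable {𝒳₀ S₀ : SchemeOver k} (f₀ : 𝒳₀ ⟶ S₀) (x : AlgPoints S₀ k)
  (t : AlgPoints ((baseChangeHom σ).obj S₀) L)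
  (ht : t.left ≫ baseChangeHomFst σ S₀ = Spec.map (CommRingCat.ofHom σ) ≫ x.left)

/-- `𝒳₀ ⊗_σ L = 𝒳₀ ×_{S₀} (S₀ ⊗_σ L)`: the base-changed family is the pullback of `f₀` along the projection
`S₀ ⊗_σ L → S₀` (pasting; this is `Motives.isPullback_baseChangeHom_map_left` of `Motives/CyclesBaseChange` and
`HodgeTheory.SpreadingOutQbar.isPullback_baseChangeHom_map_left`, re-proved to keep the imports light). [folklore] -/
private theorem isPullback_baseChangeHom_map' :
    IsPullback (baseChangeHomFst σ 𝒳₀) ((baseChangeHom σ).map f₀).left f₀.left (baseChangeHomFst σ S₀) := by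
  have hsnd : ((baseChangeHom σ).map f₀).left ≫ ((baseChangeHom σ).obj S₀).hom =
      ((baseChangeHom σ).obj 𝒳₀).hom := Over.w _
  have outer : IsPullback (baseChangeHomFst σ 𝒳₀)
      (((baseChangeHom σ).map f₀).left ≫ ((baseChangeHom σ).obj S₀).hom)
      (f₀.left ≫ S₀.hom) (Spec.map (CommRingCat.ofHom σ)) := by
    rw [hsnd, Over.w f₀]
    exact IsPullback.of_hasPullback _ _
  exact outer.of_bot (baseChangeHom_map_left_comp_fst σ f₀).symm (IsPullback.of_hasPullback _ _)

include ht in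
/-- The fibre of `f₀ ⊗_σ L` over an `L`-point `t` lying over the `k`-point `x` is the fibre product of `f₀` along
`Spec L → Spec k → S₀` (pasting the fibre square of `f₀ ⊗_σ L` at `t` with `𝒳₀ ⊗_σ L = 𝒳₀ ×_{S₀} (S₀ ⊗_σ L)`;
Görtz–Wedhorn I, §(4.8) Def. 4.25 and Prop. 4.16). [cite: GortzWedhorn2020, §(4.8) Def. 4.25 and Prop. 4.16] -/
theorem isPullback_fiberOver_baseChangeHom_map :
    IsPullback ((fiberι ((baseChangeHom σ).map f₀) t).left ≫ baseChangeHomFst σ 𝒳₀)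
      (fiberOverToSpec ((baseChangeHom σ).map f₀) t).left f₀.left
      (Spec.map (CommRingCat.ofHom σ) ≫ x.left) :=
  ht ▸ (IsPullback.of_hasPullback ((baseChangeHom σ).map f₀).left t.left).paste_horiz
    (isPullback_baseChangeHom_map' σ f₀)

/-- The structure map of the fibre `fiberOver f₀ x` is its second projection to `Spec k` (Hartshorne II.3, p. 89:
the fibre is `𝒳₀ ×_{S₀} Spec k` regarded over `Spec k`). [folklore] -/
private theorem fiberOver_hom_eq_fiberOverToSpec_left : (fiberOver f₀ x).hom = (fiberOverToSpec f₀ x).left := by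
  rw [← Over.w (fiberOverToSpec f₀ x), specOver_self_hom']
  exact Category.comp_id _

/-- The base change `(f₀⁻¹(x)) ⊗_σ L` of the fibre is the fibre product of `f₀` along `Spec L → Spec k → S₀`
(pasting the base-change square of the fibre with the fibre square at `x`; Görtz–Wedhorn I, Prop. 4.16).
[cite: GortzWedhorn2020, §(4.8) Def. 4.25 and Prop. 4.16] -/
theorem isPullback_baseChangeHom_obj_fiberOver :
    IsPullback (baseChangeHomFst σ (fiberOver f₀ x) ≫ (fiberι f₀ x).left)
      ((baseChangeHom σ).obj (fiberOver f₀ x)).hom f₀.left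
      (Spec.map (CommRingCat.ofHom σ) ≫ x.left) := by
  have sqA : IsPullback (fiberι f₀ x).left (fiberOver f₀ x).hom f₀.left x.left := by
    rw [fiberOver_hom_eq_fiberOverToSpec_left]
    exact IsPullback.of_hasPullback _ _
  exact (IsPullback.of_hasPullback (fiberOver f₀ x).hom (Spec.map (CommRingCat.ofHom σ))).paste_horiz sqA

/-- **The fibre of a base-changed family is the base change of the fibre** (Görtz–Wedhorn I, Prop. 4.16
*"`X_{(S')} ×_{S'} S'' ≅ X_{(S'')}`"* applied twice, with §(4.8) Def. 4.25; Hartshorne II.3, p. 89): for a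
`k`-morphism `f₀ : 𝒳₀ ⟶ S₀`, a field homomorphism `σ : k →+* L`, a `k`-rational point `x ∈ S₀(k)` and an `L`-point
`t` of `S₀ ⊗_σ L` lying over `x` (`t.left ≫ pr_{S₀} = Spec σ ≫ x`), the fibre of `f₀ ⊗_σ L` over `t` is
`L`-isomorphic to `(f₀⁻¹(x)) ⊗_σ L`. [cite: GortzWedhorn2020, Prop. 4.16 and §(4.8) Def. 4.25]
[cite: Hartshorne1977, Ch. II §3 p. 89 (fibre of a morphism)] -/
def fiberOverBaseChangeHomIso :
    fiberOver ((baseChangeHom σ).map f₀) t ≅ (baseChangeHom σ).obj (fiberOver f₀ x) :=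
  Over.isoMk
    ((isPullback_fiberOver_baseChangeHom_map σ f₀ x t ht).isoIsPullback _ _
      (isPullback_baseChangeHom_obj_fiberOver σ f₀ x))
    (by
      rw [fiberOver_hom_eq_fiberOverToSpec_left]
      exact (isPullback_fiberOver_baseChangeHom_map σ f₀ x t ht).isoIsPullback_hom_snd _ _
        (isPullback_baseChangeHom_obj_fiberOver σ f₀ x))

/-- `fiberOverBaseChangeHomIso` commutes with the fibre inclusions and the projections to `𝒳₀`:
`(f₀ ⊗ L)⁻¹(t) ≅ f₀⁻¹(x) ⊗ L → f₀⁻¹(x) → 𝒳₀` equals `(f₀ ⊗ L)⁻¹(t) → 𝒳₀ ⊗ L → 𝒳₀`.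
[cite: GortzWedhorn2020, Prop. 4.16 and §(4.8) Def. 4.25] -/
@[reassoc]
theorem fiberOverBaseChangeHomIso_hom_left_fst :
    (fiberOverBaseChangeHomIso σ f₀ x t ht).hom.left ≫ baseChangeHomFst σ (fiberOver f₀ x) ≫ (fiberι f₀ x).left =
      (fiberι ((baseChangeHom σ).map f₀) t).left ≫ baseChangeHomFst σ 𝒳₀ :=
  (isPullback_fiberOver_baseChangeHom_map σ f₀ x t ht).isoIsPullback_hom_fst _ _
    (isPullback_baseChangeHom_obj_fiberOver σ f₀ x)

end Fiber

/-! ## Points of `S₀ ⊗_σ L` over closed points of `S₀` (`k` algebraically closed) -/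

section Point

variable (S₀ : SchemeOver k) (t : AlgPoints ((baseChangeHom σ).obj S₀) L)

/-- The morphism `Spec L → S₀` underlying an `L`-point of `S₀ ⊗_σ L` lies over `Spec σ : Spec L → Spec k`
(Görtz–Wedhorn I, §(4.7), (4.7.1): `Hom_{S'}(T, X_{(S')}) = Hom_S(T, X)`). [cite: GortzWedhorn2020, §(4.7) eq. (4.7.1)] -/
theorem left_comp_baseChangeHomFst_comp_hom :
    (t.left ≫ baseChangeHomFst σ S₀) ≫ S₀.hom = Spec.map (CommRingCat.ofHom σ) := by
  have hc : baseChangeHomFst σ S₀ ≫ S₀.hom =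
      ((baseChangeHom σ).obj S₀).hom ≫ Spec.map (CommRingCat.ofHom σ) := pullback.condition
  rw [Category.assoc, hc, ← Category.assoc, Over.w t, specOver_self_hom']
  exact Category.id_comp _

/-- **An `L`-point of `S₀ ⊗_σ L` over a closed point of `S₀` lies over a `k`-rational point**, for `k`
algebraically closed and `S₀` locally of finite type over `k`: if the image in `S₀` of `t ∈ (S₀ ⊗_σ L)(L)` is a
closed point `s₀`, then `κ(s₀) = k` (Görtz–Wedhorn I, Prop. 3.35 / Cor. 3.36 — Hilbert's Nullstellensatz: *"Let
`k` be algebraically closed … the closed points of `X` are the `k`-valued points"*; Mathlib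
`AlgebraicGeometry.pointOfClosedPoint`), and since a morphism `Spec L → S₀` is the datum of its image point and an
embedding of the residue field (loc. cit. Prop. 3.8; Mathlib
`Scheme.descResidueField_stalkClosedPointTo_fromSpecResidueField`), the compatibility with `Spec σ` forces
`Spec L → S₀` to be `Spec σ` followed by the `k`-point `x` at `s₀`: `t.left ≫ pr_{S₀} = Spec σ ≫ x`.
[cite: GortzWedhorn2020, Prop. 3.35, Cor. 3.36 and Prop. 3.8] -/
theorem exists_algPoints_over_of_isClosed [IsAlgClosed k] [LocallyOfFiniteType S₀.hom]
    (ht : IsClosed ({(baseChangeHomFst σ S₀).base t.pt} : Set S₀.left)) :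
    ∃ x : AlgPoints S₀ k, t.left ≫ baseChangeHomFst σ S₀ = Spec.map (CommRingCat.ofHom σ) ≫ x.left := by
  set u : Spec (.of L) ⟶ S₀.left := t.left ≫ baseChangeHomFst σ S₀ with hu
  set s₀ : S₀.left := u (IsLocalRing.closedPoint L) with hs₀
  have hs : IsClosed ({s₀} : Set S₀.left) := ht
  let ι := residueFieldIsoBase S₀.hom s₀ hs
  refine ⟨AlgPoints.mk (pointOfClosedPoint S₀.hom s₀ hs) (by
    rw [pointOfClosedPoint_comp, Algebra.algebraMap_self, CommRingCat.ofHom_id, Spec.map_id]), ?_⟩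
  change u = Spec.map (CommRingCat.ofHom σ) ≫ pointOfClosedPoint S₀.hom s₀ hs
  -- `u` factors through the residue field of `s₀`
  have hfac := Scheme.descResidueField_stalkClosedPointTo_fromSpecResidueField L S₀.left u
  set φ := Scheme.descResidueField (Scheme.stalkClosedPointTo u) with hφ
  -- `ψ : k → L`, the composite `k ≅ κ(s₀) → L`
  let ψ : CommRingCat.of k ⟶ CommRingCat.of L := ι.inv ≫ φ
  have hu' : u = Spec.map ψ ≫ pointOfClosedPoint S₀.hom s₀ hs := by
    have hι : ∀ {Z : Scheme.{u}} (h : Spec (S₀.left.residueField s₀) ⟶ Z),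
        Spec.map ι.inv ≫ Spec.map ι.hom ≫ h = h := fun h => by
      rw [← Category.assoc, ← Spec.map_comp, Iso.hom_inv_id, Spec.map_id, Category.id_comp]
    change u = Spec.map (ι.inv ≫ φ) ≫ Spec.map ι.hom ≫ S₀.left.fromSpecResidueField s₀
    rw [Spec.map_comp, Category.assoc, hι]
    exact hfac.symm
  -- `ψ = σ`, by comparing the structure maps to `Spec k`
  have hψ : ψ = CommRingCat.ofHom σ := by
    have h1 : u ≫ S₀.hom = Spec.map (CommRingCat.ofHom σ) := left_comp_baseChangeHomFst_comp_hom σ S₀ t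
    rw [hu', Category.assoc, pointOfClosedPoint_comp, Category.comp_id] at h1
    exact Spec.map_injective h1
  rw [hu', hψ]

end Point

end Literature.AlgebraicGeometry.Motives

end
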